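import Summits.BirchSwinnertonDyer.Rank1Residual.X11b.BDPRouteRTDegree
import HarnessLib

/-!
# Class X11b, route "BDP + converse-theorem engine + Kolyvagin": the degree-ratio identity (DEG) by telescoping (Pasten §6.9 at a non-Eisenstein prime) (cell `b2b-bsdres`, sub-cell `multr1-p2`, gen 10)

HONEST FRAMING (verbatim, cell `b2b-bsdres`): the goal of the cell is to DELETE the
COMBINATION-SHAPED residual classes for ALL analytic-rank `≤ 1` curves over `ℚ` — "full BSD
formula for every rank `≤ 1` curve in class `C`" assembled STRICTLY from published theorems — so
that the rank-`≤ 1` remainder becomes exactly the CONSTRUCTION-SHAPED classes, which are TYPED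
(missing-input Props), NOT attempted; this is not "finishing BSD". Research route `p2` for class
X11b; no claim beyond the stated class; nothing booked; X11b stays CONSTRUCTION-SHAPED. THEOREMS
ONLY (no definition, no named fact); continuation of `BDPRouteRTDegree.lean` (same abstract
package (P613), (Pij), (P68), (PEis) at a prime `ℓ`; see its module docstring for the audit of the
display (GZ-Sh), the locators in Pasten 2024 §6, and the gap in Takahashi 2001).

## What this file proves

* `padicValNat_delta_empty_step` — one step of §6.9 (EqSequentially) in sum form;
* `padicValNat_delta_empty_eq_of_witness_mem` / `…_of_two_outside` / `…_of_witness` — **(DEG)**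
  `ord_ℓ δ(N,1) = ord_ℓ δ(N⁺,N⁻) + Σ_{q∣N⁻} ord_ℓ c_q(E)` for an inert set `N⁻ = S` of even size, from ONE
  (ram) witness `ℓ₀` (`ℓ ∤ c_{ℓ₀}(E)`) and one further multiplicative prime `t ∉ S`, `t ≠ ℓ₀` (class
  X11b: `t = p ∥ N⁺`, the BSD prime itself) — Lemma 6.15 if `ℓ₀ ∈ S`, Lemma 6.16 if `ℓ₀ ∉ S`; no
  Takahashi 2001, no condition on `N⁺`;
* `padicValNat_delta_empty_eq_of_pairing` — (DEG) from the Papikian–Rabinoff cokernel bound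
  `j_q ∣ q − 1` (Pasten Lemma 6.18) when half of `S` consists of primes `q ≢ 1 (mod ℓ)` — the rescue
  available in Jetchev–Skinner–Wan's own `p ∤ N` setting (`N⁺ = q₁` a single prime).

Consumer: `X11b/BDPRouteUpperDegree.lean`. CONDITIONAL on displayed shapes there; nothing booked.

## References

* [PastenShimura2024] H. Pasten, J. Number Theory 254 (2024) = arXiv:1705.09251, Prop. 6.13 (arXiv v4
  p. 30), Lemmas 6.15/6.16 (pp. 31–32), Lemma 6.18 and §6.9 (EqSequentially) (p. 33).
* [PapikianRabinoff2016] M. Papikian, J. Rabinoff, Canad. J. Math. 68 (2016) = arXiv:1212.3574, Cor. 3.5.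
* [WZhang2014] W. Zhang, Camb. J. Math. 2 (2014), p. 229 and p. 245. [JetchevSkinnerWan2017] §7.4.2 (p. 31).
-/

open Finset

namespace Summit.BirchSwinnertonDyer.Rank1Residual.X11b.RTDegree

variable {ℓ : ℕ} [Fact ℓ.Prime]

section Telescope

variable {Mult : Finset ℕ} {δ : Finset ℕ → ℕ} {cA ι κ : Finset ℕ → ℕ → ℕ} {c : ℕ → ℕ}
  -- (P613) Pasten Prop. 6.13 (both expressions, by symmetry in `q`, `r`)
  (h613 : ∀ ⦃d : Finset ℕ⦄, d ⊆ Mult → Even d.card → ∀ ⦃q r : ℕ⦄, q ∈ Mult → r ∈ Mult →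
    q ∉ d → r ∉ d → q ≠ r →
    δ d * ι d q ^ 2 * κ (insert q (insert r d)) r ^ 2 =
      δ (insert q (insert r d)) * cA d q * cA (insert q (insert r d)) r)
  -- positivity of degrees and component numbers
  (hδ : ∀ D, 0 < δ D) (hcA : ∀ D q, 0 < cA D q)
  -- (Pij) image · cokernel = `#Φ_q(A_{D,M}) = c_q(A_{D,M})`
  (hij : ∀ ⦃D : Finset ℕ⦄, D ⊆ Mult → ∀ ⦃q : ℕ⦄, q ∈ Mult → ι D q * κ D q = cA D q)
  -- (P68) at `ℓ`: `ord_ℓ c_q(A_{D,M}) = ord_ℓ c_q(E)`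
  (hvA : ∀ ⦃D : Finset ℕ⦄, D ⊆ Mult → ∀ ⦃q : ℕ⦄, q ∈ Mult →
    padicValNat ℓ (cA D q) = padicValNat ℓ (c q))
  -- (PEis) at `ℓ`: the image terms are `ℓ`-adic units
  (hι : ∀ ⦃d : Finset ℕ⦄, d ⊆ Mult → ∀ ⦃q : ℕ⦄, q ∈ Mult → q ∉ d → padicValNat ℓ (ι d q) = 0)

include h613 hδ hcA hij hvA hι

/-- One telescoping step in SUM form: if `ord_ℓ δ(∅) = ord_ℓ δ(d) + Σ_{d} ord_ℓ c` and the cokernel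
term of the new level `D = d ∪ {q, r}` at `r` is an `ℓ`-unit, then
`ord_ℓ δ(∅) = ord_ℓ δ(D) + Σ_{D} ord_ℓ c`. [cite: PastenShimura2024, §6.9 (EqSequentially) (arXiv v4 p. 33)] -/
theorem padicValNat_delta_empty_step
    {d : Finset ℕ} (hd : d ⊆ Mult) (hde : Even d.card) {q r : ℕ} (hq : q ∈ Mult) (hr : r ∈ Mult)
    (hqd : q ∉ d) (hrd : r ∉ d) (hqr : q ≠ r)
    (hκ : padicValNat ℓ (κ (insert q (insert r d)) r) = 0)
    (IH : padicValNat ℓ (δ ∅) = padicValNat ℓ (δ d) + ∑ x ∈ d, padicValNat ℓ (c x)) :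
    padicValNat ℓ (δ ∅) =
      padicValNat ℓ (δ (insert q (insert r d))) + ∑ x ∈ insert q (insert r d), padicValNat ℓ (c x) := by
  have hs := padicValNat_step h613 hδ hcA hij hvA hι hd hde hq hr hqd hrd hqr
  have hq' : q ∉ insert r d := by simp [hqr, hqd]
  rw [Finset.sum_insert hq', Finset.sum_insert hrd]
  omega

/-- **Telescoping with a (ram) witness INSIDE `S`** (Pasten §6.9 at `ℓ`, the witness put in the
first pair): `S ⊆ Mult`, `#S = 2n`, `ℓ₀ ∈ S` with `ord_ℓ c_{ℓ₀}(E) = 0` (or `S = ∅`) ⟹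
`ord_ℓ δ(∅) = ord_ℓ δ(S) + Σ_{q∈S} ord_ℓ c_q(E)`. [cite: PastenShimura2024, §6.9 (arXiv v4 p. 33) and Lemma 6.15 (p. 31)] -/
theorem padicValNat_delta_empty_eq_of_witness_mem
    {ℓ₀ : ℕ} (hw : padicValNat ℓ (c ℓ₀) = 0) :
    ∀ (n : ℕ) (S : Finset ℕ), S ⊆ Mult → S.card = 2 * n → (S = ∅ ∨ ℓ₀ ∈ S) →
      padicValNat ℓ (δ ∅) = padicValNat ℓ (δ S) + ∑ x ∈ S, padicValNat ℓ (c x) := by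
  intro n
  induction n with
  | zero =>
    intro S _ hS _
    rw [Finset.card_eq_zero.mp (by omega : S.card = 0)]
    simp
  | succ n IH =>
    intro S hS hcard hℓ₀
    have hℓ₀S : ℓ₀ ∈ S := by
      rcases hℓ₀ with h | h
      · subst h; simp at hcard
      · exact h
    have hSe : Even S.card := ⟨n + 1, by omega⟩
    -- every cokernel term of level `S` is a unit (witness inside)
    have hκS : ∀ x ∈ S, padicValNat ℓ (κ S x) = 0 := fun x hx ↦
      padicValNat_coker_eq_zero_of_witness_mem h613 hδ hcA hij hvA hι hS hSe hℓ₀S hw hx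
    -- choose the pair `{q, r}` to remove, keeping `ℓ₀` unless `S = {ℓ₀, r}`
    have hne : (S.erase ℓ₀).Nonempty := by
      apply Finset.card_pos.mp; rw [Finset.card_erase_of_mem hℓ₀S]; omega
    obtain ⟨r, hr⟩ := hne
    obtain ⟨hrℓ, hrS⟩ := Finset.mem_erase.mp hr
    -- `q`: if `n = 0` take `ℓ₀`, else a third element
    have hq : ∃ q ∈ S, q ≠ r ∧ (n = 0 ∨ q ≠ ℓ₀) := by
      by_cases hn : n = 0
      · exact ⟨ℓ₀, hℓ₀S, Ne.symm hrℓ, Or.inl hn⟩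
      · have hne' : ((S.erase ℓ₀).erase r).Nonempty := by
          apply Finset.card_pos.mp
          rw [Finset.card_erase_of_mem hr, Finset.card_erase_of_mem hℓ₀S]; omega
        obtain ⟨q, hq⟩ := hne'
        obtain ⟨hqr, hq'⟩ := Finset.mem_erase.mp hq
        obtain ⟨hqℓ, hqS⟩ := Finset.mem_erase.mp hq'
        exact ⟨q, hqS, hqr, Or.inr hqℓ⟩
    obtain ⟨q, hqS, hqr, hqn⟩ := hq
    set d := (S.erase q).erase r with hd_def
    have hrq' : r ∈ S.erase q := Finset.mem_erase.mpr ⟨hqr.symm, hrS⟩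
    have hSeq : insert q (insert r d) = S := by
      rw [hd_def, Finset.insert_erase hrq', Finset.insert_erase hqS]
    have hdS : d ⊆ S := (Finset.erase_subset _ _).trans (Finset.erase_subset _ _)
    have hd : d ⊆ Mult := hdS.trans hS
    have hqd : q ∉ d := fun h ↦ (Finset.notMem_erase q S) ((Finset.erase_subset r _) h)
    have hrd : r ∉ d := Finset.notMem_erase r _
    have hdcard : d.card = 2 * n := by
      have h1 := Finset.card_erase_of_mem hqS
      have h2 := Finset.card_erase_of_mem hrq'
      rw [hd_def]; omega
    have hde : Even d.card := ⟨n, by omega⟩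
    have hdℓ : d = ∅ ∨ ℓ₀ ∈ d := by
      rcases hqn with hn | hqℓ
      · left; subst hn; exact Finset.card_eq_zero.mp (by omega)
      · right
        exact Finset.mem_erase.mpr ⟨Ne.symm hrℓ, Finset.mem_erase.mpr ⟨Ne.symm hqℓ, hℓ₀S⟩⟩
    have IH' := IH d hd hdcard hdℓ
    have hκ : padicValNat ℓ (κ (insert q (insert r d)) r) = 0 := by
      rw [hSeq]; exact hκS r hrS
    have := padicValNat_delta_empty_step h613 hδ hcA hij hvA hι hd hde (hS hqS) (hS hrS) hqd hrd hqr
      hκ IH'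
    rwa [hSeq] at this

/-- **Telescoping with two multiplicative primes OUTSIDE `S`** (Pasten §6.9 with Lemma 6.16 at
`ℓ`): `S ⊆ Mult`, `#S = 2n`, `r ≠ t` in `Mult ∖ S` with `ord_ℓ c_r(E) = 0` ⟹
`ord_ℓ δ(∅) = ord_ℓ δ(S) + Σ_{q∈S} ord_ℓ c_q(E)`. [cite: PastenShimura2024, §6.9 (arXiv v4 p. 33) and Lemma 6.16 (p. 32)] -/
theorem padicValNat_delta_empty_eq_of_two_outside
    {r t : ℕ} (hr : r ∈ Mult) (ht : t ∈ Mult) (hrt : r ≠ t) (hw : padicValNat ℓ (c r) = 0) :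
    ∀ (n : ℕ) (S : Finset ℕ), S ⊆ Mult → S.card = 2 * n → r ∉ S → t ∉ S →
      padicValNat ℓ (δ ∅) = padicValNat ℓ (δ S) + ∑ x ∈ S, padicValNat ℓ (c x) := by
  intro n
  induction n with
  | zero =>
    intro S _ hS _ _
    rw [Finset.card_eq_zero.mp (by omega : S.card = 0)]
    simp
  | succ n IH =>
    intro S hS hcard hrS htS
    have hSe : Even S.card := ⟨n + 1, by omega⟩
    have hne : S.Nonempty := Finset.card_pos.mp (by omega)
    obtain ⟨q, hqS⟩ := hne
    have hne' : (S.erase q).Nonempty := by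
      apply Finset.card_pos.mp; rw [Finset.card_erase_of_mem hqS]; omega
    obtain ⟨q', hq'⟩ := hne'
    obtain ⟨hq'q, hq'S⟩ := Finset.mem_erase.mp hq'
    set d := (S.erase q).erase q' with hd_def
    have hSeq : insert q (insert q' d) = S := by
      rw [hd_def, Finset.insert_erase hq', Finset.insert_erase hqS]
    have hdS : d ⊆ S := (Finset.erase_subset _ _).trans (Finset.erase_subset _ _)
    have hd : d ⊆ Mult := hdS.trans hS
    have hqd : q ∉ d := fun h ↦ (Finset.notMem_erase q S) ((Finset.erase_subset q' _) h)
    have hq'd : q' ∉ d := Finset.notMem_erase q' _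
    have hdcard : d.card = 2 * n := by
      have h1 := Finset.card_erase_of_mem hqS
      have h2 := Finset.card_erase_of_mem hq'
      rw [hd_def]; omega
    have hde : Even d.card := ⟨n, by omega⟩
    have IH' := IH d hd hdcard (fun h ↦ hrS (hdS h)) (fun h ↦ htS (hdS h))
    have hκ : padicValNat ℓ (κ (insert q (insert q' d)) q') = 0 := by
      rw [hSeq]
      exact padicValNat_coker_eq_zero_of_two_outside h613 hδ hcA hij hvA hι hS hSe hq'S hr ht hrS htS
        hrt hw
    have := padicValNat_delta_empty_step h613 hδ hcA hij hvA hι hd hde (hS hqS) (hS hq'S) hqd hq'd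
      (Ne.symm hq'q) hκ IH'
    rwa [hSeq] at this

/-- **(DEG) — the exact degree-ratio identity at a non-Eisenstein prime, from ONE (ram) witness and
ONE more multiplicative prime outside `S`.** `S ⊆ Mult` of even cardinality (the inert set `N⁻` of a
JSW field), `ℓ₀ ∈ Mult` with `ord_ℓ c_{ℓ₀}(E) = 0`, and `t ∈ Mult ∖ S`, `t ≠ ℓ₀` (class X11b: `t = p`)
⟹ `ord_ℓ δ(N,1) = ord_ℓ δ(N⁺,N⁻) + Σ_{q∈N⁻} ord_ℓ c_q(E)` — whether the witness is inert
(`ℓ₀ ∈ S`, Lemma 6.15) or split (`ℓ₀ ∉ S`, Lemma 6.16 with the pair `{ℓ₀, t} ⊆ N⁺`). This is the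
`p`-adic unit statement "`δ(N,1)/δ(N⁺,N⁻) = ∏_{ℓ∣N⁻} c_ℓ(E/K″)`" of JSW 2017 §7.4.2 / W. Zhang 2014
p. 245, obtained WITHOUT Takahashi 2001 and without any condition on `N⁺`, from Pasten's printed
identities read at `ℓ`. [cite: PastenShimura2024, Prop. 6.13 (arXiv v4 p. 30), Lemmas 6.15–6.16 (pp. 31–32), §6.9 (p. 33)]
[cite: WZhang2014, §10 p. 245 and proof of Thm. 6.4 p. 229] [cite: JetchevSkinnerWan2017, §7.4.2 (p. 31)] -/
theorem padicValNat_delta_empty_eq_of_witness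
    {S : Finset ℕ} (hS : S ⊆ Mult) (hSe : Even S.card)
    {ℓ₀ t : ℕ} (hℓ₀ : ℓ₀ ∈ Mult) (hw : padicValNat ℓ (c ℓ₀) = 0) (ht : t ∈ Mult) (htS : t ∉ S)
    (htℓ : t ≠ ℓ₀) :
    padicValNat ℓ (δ ∅) = padicValNat ℓ (δ S) + ∑ x ∈ S, padicValNat ℓ (c x) := by
  obtain ⟨n, hn⟩ := hSe
  by_cases hmem : ℓ₀ ∈ S
  · exact padicValNat_delta_empty_eq_of_witness_mem h613 hδ hcA hij hvA hι hw n S hS (by omega)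
      (Or.inr hmem)
  · exact padicValNat_delta_empty_eq_of_two_outside h613 hδ hcA hij hvA hι hℓ₀ ht (Ne.symm htℓ) hw n S
      hS (by omega) hmem htS

/-- **(DEG) from the Papikian–Rabinoff cokernel bound alone** (the rescue available in JSW's own
`p ∤ N` setting): if (P618) `j_q(D) ∣ q − 1` for the primes `q ≥ 2` of every level, and `S` (even) has a
subset `R` of half its size consisting of primes `q` with `ℓ ∤ q − 1`, then pairing each prime of
`S ∖ R` with one of `R` (cokernel taken on the `R`-side) gives
`ord_ℓ δ(∅) = ord_ℓ δ(S) + Σ_{q∈S} ord_ℓ c_q(E)`.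
[cite: PastenShimura2024, Lemma 6.18 and §6.9 (arXiv v4 p. 33)] [cite: PapikianRabinoff2016, Cor. 3.5] -/
theorem padicValNat_delta_empty_eq_of_pairing
    (h618 : ∀ ⦃D : Finset ℕ⦄, D ⊆ Mult → ∀ ⦃q : ℕ⦄, q ∈ D → κ D q ∣ q - 1) :
    ∀ (n : ℕ) (S R : Finset ℕ), S ⊆ Mult → R ⊆ S → S.card = 2 * n → R.card = n →
      (∀ q ∈ R, ¬ ℓ ∣ q - 1) →
      padicValNat ℓ (δ ∅) = padicValNat ℓ (δ S) + ∑ x ∈ S, padicValNat ℓ (c x) := by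
  intro n
  induction n with
  | zero =>
    intro S R _ _ hS _ _
    rw [Finset.card_eq_zero.mp (by omega : S.card = 0)]
    simp
  | succ n IH =>
    intro S R hS hRS hScard hRcard hR
    -- `r ∈ R`, `q ∈ S ∖ R`
    obtain ⟨r, hrR⟩ : R.Nonempty := Finset.card_pos.mp (by omega)
    have hrS : r ∈ S := hRS hrR
    have hne : (S \ R).Nonempty := by
      apply Finset.card_pos.mp
      rw [Finset.card_sdiff_of_subset hRS]; omega
    obtain ⟨q, hq⟩ := hne
    obtain ⟨hqS, hqR⟩ := Finset.mem_sdiff.mp hq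
    have hqr : q ≠ r := fun h ↦ hqR (h ▸ hrR)
    set d := (S.erase q).erase r with hd_def
    have hrq' : r ∈ S.erase q := Finset.mem_erase.mpr ⟨hqr.symm, hrS⟩
    have hSeq : insert q (insert r d) = S := by
      rw [hd_def, Finset.insert_erase hrq', Finset.insert_erase hqS]
    have hdS : d ⊆ S := (Finset.erase_subset _ _).trans (Finset.erase_subset _ _)
    have hd : d ⊆ Mult := hdS.trans hS
    have hqd : q ∉ d := fun h ↦ (Finset.notMem_erase q S) ((Finset.erase_subset r _) h)
    have hrd : r ∉ d := Finset.notMem_erase r _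
    have hdcard : d.card = 2 * n := by
      have h1 := Finset.card_erase_of_mem hqS
      have h2' := Finset.card_erase_of_mem hrq'
      rw [hd_def]; omega
    have hde : Even d.card := ⟨n, by omega⟩
    -- the new `R`
    have hR'd : R.erase r ⊆ d := by
      intro x hx
      obtain ⟨hxr, hxR⟩ := Finset.mem_erase.mp hx
      have hxq : x ≠ q := fun h ↦ hqR (h ▸ hxR)
      exact Finset.mem_erase.mpr ⟨hxr, Finset.mem_erase.mpr ⟨hxq, hRS hxR⟩⟩
    have hR'card : (R.erase r).card = n := by rw [Finset.card_erase_of_mem hrR]; omega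
    have IH' := IH d (R.erase r) hd hR'd hdcard hR'card
      (fun x hx ↦ hR x (Finset.mem_of_mem_erase hx))
    -- the cokernel at `r` of level `S` divides `r - 1`, an `ℓ`-unit
    have hκ : padicValNat ℓ (κ (insert q (insert r d)) r) = 0 := by
      rw [hSeq]
      apply padicValNat.eq_zero_of_not_dvd
      intro hdvd
      exact hR r hrR (dvd_trans hdvd (h618 hS hrS))
    have := padicValNat_delta_empty_step h613 hδ hcA hij hvA hι hd hde (hS hqS) (hS hrS) hqd hrd hqr
      hκ IH'
    rwa [hSeq] at this

end Telescope

end Summit.BirchSwinnertonDyer.Rank1Residual.X11b.RTDegree
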